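/-
Copyright (c) 2026 the pub-hodgecm-mathlib formalisation cell (harness21).  Prover seat hodgecm-mathlib-K2E1-p08 (g4), Track B ∕ K2-LIT, h413 =
`stmt-HodgeConjecture-24833`, line `K2_E1_TraceFormulaBeta`, campaign «RES-RANK-ONE»; DEAL «(H4-a) ELIMINATION» of the dealer K2E1-plan (g2) 2026-09-04T03:26:16Z, FILE I
(generic functional analysis): test functions CENTRALISED over a compact group `K → G`, their integrated operators commute with `π(K)`, and `K`-central approximate identities.
-/
import Summits.HodgeConjecture.HodgeConjecture.Theorems.K2E1TwistIntegratedOperator        -- ★ p856770 (K2E1-p08 g3): `comp_integratedOperator_of_conj_intertwining` (conj-equivariant transport of `π(f)`)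
import Literature.MeasureTheory.Group.HaarRightInvariantCompactSubgroup                    -- ★ `map_mul_right_eq_self_of_mem_isCompact` (left Haar is right-invariant under a compact subgroup)
import Literature.NumberTheory.Automorphic.IntegratedOperatorDiscreteness                  -- ★ `exists_dirac_function` (non-negative bumps of positive mass in any unit neighbourhood)
import HarnessLib

/-!
# K2·E1 — `K2E1CentralTestFunctions`: `K`-CENTRAL TEST FUNCTIONS — centralisation `η ↦ η^K`, `π(ιk) ∘ π(η^K) = π(η^K) ∘ π(ιk)`, and `K`-central approximate identities
# (campaign «RES-RANK-ONE», (H4-a) elimination, file I: generic)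

Track B ∕ K2-LIT, crux h413 = `stmt-HodgeConjecture-24833`, route of record `HCCMUnconditional`; cell `hodgecm-mathlib`, squad K2, ENGINE E1.  Prover seat `hodgecm-mathlib-K2E1-p08`
(g4); DEAL «(H4-a) ELIMINATION» of the dealer K2E1-plan (g2) 2026-09-04T03:26:16Z (drop the regularity input `hreg` of ★ p857039 `finiteDimensional_of_reg_exp` by smoothing with
`K`-central test functions), FILE I = the generic functional analysis.  THEOREMS ONLY (no `def`, no `instance`, no notation, no named-fact hypothesis, no `sorry`); lane
`--supports stmt-HodgeConjecture-24833 --as helper` (count-neutral).  Closes no socket.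

SETTING.  `G` a second countable locally compact Hausdorff group with a (left) Haar measure `ν`; `K` a compact group with a continuous homomorphism `ι : K →* G` (print:
`K = K_∞K_f ≤ G(𝔸)`); `π` a unitary strongly continuous representation of `G` on a Hilbert space (★ `ContRepresentation.integratedOperator`, `π(f) = ∫ f(g)π(g) dν`).

WHAT.
* §1 CONJUGATION BY `ι(K)` PRESERVES `ν`: `measurePreserving_conj` (`g ↦ ιk·g·(ιk)⁻¹`) and `measurePreserving_conj_inv` (`g ↦ (ιk)⁻¹·g·ιk`) — left invariance + ★
  `map_mul_right_eq_self_of_mem_isCompact` at the compact subgroup `ι(K)` (the modular function is trivial on compact subgroups [Folland1995, Prop. 2.27]).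
* §2 CENTRALISATION `exists_centralisation`: for `η ∈ C_c(G, ℂ)` and a Haar measure `μ_K` on `K` there is `η^K ∈ C_c(G, ℂ)` with `η^K(g) = ∫_K η((ιk)⁻¹ g ιk) dμ_K(k)` (continuity:
  Mathlib `continuous_parametric_integral_of_continuous`; support `⊆ ι(K)·tsupport η·ι(K)⁻¹`, compact); it is `K`-CENTRAL, `η^K(ιk·g·(ιk)⁻¹) = η^K(g)` (left invariance of
  `μ_K`); `re_im_centralisation` (real non-negative `η` gives real non-negative `η^K`); `integral_re_centralisation` (`∫_G re η^K dν = μ_K(K) · ∫_G re η dν`, Fubini + §1).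
* §3 COMMUTATION `comp_integratedOperator_of_central`: for `K`-central `f`, **`π(ιk) ∘ π(f) = π(f) ∘ π(ιk)`** (★ `comp_integratedOperator_of_conj_intertwining` with `θ =` conjugation, §1).
* §4 `K`-CENTRAL APPROXIMATE IDENTITIES: `exists_nhds_forall_conj_mem` (tube lemma: `U ∋ 1` with `ιk·U·(ιk)⁻¹ ⊆ V` for all `k`), `exists_central_dirac` (a `K`-central real
  non-negative `f ∈ C_c` of `ν`-mass `1` supported in a given `V ∋ 1`: centralise a ★ `exists_dirac_function` bump supported in `U` and normalise), and
  `norm_integratedOperator_apply_sub_self_le` (the Dirac estimate `‖π(f)v − v‖ ≤ δ` for real non-negative `f` of mass `1` supported where `‖π(g)v − v‖ ≤ δ` — the generic twin of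
  ★ `QuaternionUnitsMultiplicityOneOfTestFamily.norm_integratedOperator_apply_sub_le_of_integral_eq_one`, whose module is outside the built library) and
  **`exists_central_norm_integratedOperator_apply_sub_le`**: for every vector `v` and `ε > 0` a `K`-central `f ∈ C_c(G)` with `‖π(f)v − v‖ ≤ ε`.
FILE II (`K2E1ResidualAdmissibleOfExponentsSmooth`) applies this to `π = R|_{L²_res}`: `π(f)` for `K`-central `f` preserves every `K`-isotypic part (★ `map_homRangeSum_le_of_commute`), its
values have continuous representatives (★ `toLp_orbitalSmoothing_eq`), and §4 makes them dense — so ★ p857039's `hreg` is automatic and 5Res ∕ 12R3 read «⟸ (H4-b) exponent finiteness» alone.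
HONEST LABEL: HC_CM is proved only modulo the 7 printed citations (2 remaining named inputs: hLiu418 = `stmt-HodgeConjecture-24832`, h413 = `stmt-HodgeConjecture-24833`) until rung 0
closes; this file is generic functional analysis, asserts no named fact and closes no socket.
References: [Folland1995] G. B. Folland, *A Course in Abstract Harmonic Analysis* (1995), Prop. 2.27, Cor. 2.28, Prop. 2.42, §3.1 · [DeitmarEchterhoff2014] A. Deitmar, S. Echterhoff,
*Principles of Harmonic Analysis*, 2nd ed. (2014), Lemma 1.6.5, Lemma 6.2.2, Lemma 9.2.7 · [HarishChandra1968] Harish-Chandra, LNM 62 (1968), Lemma «φ = φ ∗ α» (the role of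
`K`-central approximate identities) · [BorelJacquet1979] §4.3.
-/

set_option autoImplicit false
-- the mandated namespace repeats the single-problem summit's segment (`HodgeConjecture.HodgeConjecture`)
set_option linter.dupNamespace false

noncomputable section

open MeasureTheory Measure Filter Topology Set CompactlySupported Function
open scoped ENNReal NNReal Pointwise
open Literature.NumberTheory.Automorphic
open Literature.MeasureTheory.Group (map_mul_right_eq_self_of_mem_isCompact)
open Summit.HodgeConjecture.HodgeConjecture.Cruxes.H413.K2E1TwistIntegratedOperator (comp_integratedOperator_of_conj_intertwining)

namespace Summit.HodgeConjecture.HodgeConjecture.Cruxes.H413.K2E1CentralTestFunctions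

variable {G : Type*} [Group G] [TopologicalSpace G] [IsTopologicalGroup G] [LocallyCompactSpace G] [SecondCountableTopology G] [T2Space G]
  [MeasurableSpace G] [BorelSpace G] (ν : Measure G) [ν.IsHaarMeasure]
  {K : Type*} [Group K] [TopologicalSpace K] [CompactSpace K] {ι : K →* G}

/-! ## §1 Conjugation by `ι(K)` preserves the Haar measure of `G` -/

omit [IsTopologicalGroup G] [LocallyCompactSpace G] [SecondCountableTopology G] [T2Space G] [MeasurableSpace G] [BorelSpace G] in
/-- `ι(K)` is a compact subgroup of `G`. [folklore] -/
theorem isCompact_coe_range (hι : Continuous ι) : IsCompact ((ι.range : Subgroup G) : Set G) := by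
  rw [MonoidHom.coe_range]
  exact isCompact_range hι

/-- Right multiplication by `ι k` preserves the (left) Haar measure `ν` (★ `map_mul_right_eq_self_of_mem_isCompact`: the modular function is trivial on the compact subgroup `ι(K)`).
[cite: Folland1995, Prop. 2.27 and Cor. 2.28] -/
theorem measurePreserving_mul_right_of_compact (hι : Continuous ι) (k : K) : MeasurePreserving (fun g : G => g * ι k) ν ν :=
  ⟨measurable_mul_const _, map_mul_right_eq_self_of_mem_isCompact ν ι.range (isCompact_coe_range hι) ⟨k, rfl⟩⟩

/-- **Conjugation `g ↦ ιk·g·(ιk)⁻¹` preserves `ν`.** [cite: Folland1995, Prop. 2.27 and Cor. 2.28] -/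
theorem measurePreserving_conj (hι : Continuous ι) (k : K) : MeasurePreserving (fun g : G => ι k * g * (ι k)⁻¹) ν ν := by
  have h1 : MeasurePreserving (fun g : G => ι k * g) ν ν := measurePreserving_mul_left ν (ι k)
  have h2 : MeasurePreserving (fun g : G => g * ι k⁻¹) ν ν := measurePreserving_mul_right_of_compact ν hι k⁻¹
  have h := h2.comp h1
  rwa [map_inv] at h

/-- **Conjugation `g ↦ (ιk)⁻¹·g·ιk` preserves `ν`.** [cite: Folland1995, Prop. 2.27 and Cor. 2.28] -/
theorem measurePreserving_conj_inv (hι : Continuous ι) (k : K) : MeasurePreserving (fun g : G => (ι k)⁻¹ * g * ι k) ν ν := by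
  have h := measurePreserving_conj ν hι k⁻¹
  simp only [map_inv, inv_inv] at h
  exact h

omit [LocallyCompactSpace G] [SecondCountableTopology G] [T2Space G] in
/-- Conjugation is a measurable embedding (a homeomorphism). [folklore] -/
theorem measurableEmbedding_conj (a : G) : MeasurableEmbedding (fun g : G => a * g * a⁻¹) :=
  ((Homeomorph.mulLeft a).trans (Homeomorph.mulRight a⁻¹)).measurableEmbedding

omit [LocallyCompactSpace G] [SecondCountableTopology G] [T2Space G] in
/-- `g ↦ a⁻¹ g a` is a measurable embedding. [folklore] -/
theorem measurableEmbedding_conj_inv' (a : G) : MeasurableEmbedding (fun g : G => a⁻¹ * g * a) := by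
  have h := measurableEmbedding_conj (G := G) a⁻¹
  simp only [inv_inv] at h
  exact h

/-! ## §2 Centralisation of a test function over `K` -/

variable [IsTopologicalGroup K]

section Centralisation

variable [MeasurableSpace K] [BorelSpace K] (μK : Measure K) [μK.IsHaarMeasure]

omit [LocallyCompactSpace G] [SecondCountableTopology G] [T2Space G] [MeasurableSpace G] [BorelSpace G] [IsTopologicalGroup K] [CompactSpace K]
  [MeasurableSpace K] [BorelSpace K] in
/-- The centralisation integrand `(g, k) ↦ η((ιk)⁻¹ g ιk)` is jointly continuous. [folklore] -/
theorem continuous_conj_integrand (hι : Continuous ι) (η : C_c(G, ℂ)) : Continuous (fun p : G × K => η ((ι p.2)⁻¹ * p.1 * ι p.2)) :=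
  η.continuous.comp ((((hι.comp continuous_snd).inv).mul continuous_fst).mul (hι.comp continuous_snd))

omit [MeasurableSpace G] [BorelSpace G] in
/-- **CENTRALISATION.**  For `η ∈ C_c(G, ℂ)` there is `η^K ∈ C_c(G, ℂ)` with `η^K(g) = ∫_K η((ιk)⁻¹ g ιk) dμ_K(k)` for all `g`; it is `K`-CENTRAL: `η^K(ιk·g·(ιk)⁻¹) = η^K(g)` (left invariance
of `μ_K`).  Continuity by Mathlib `continuous_parametric_integral_of_continuous` (compact `K`); the support lies in the compact `{ιk·x·(ιk)⁻¹ : k ∈ K, x ∈ tsupport η}`.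
[cite: HarishChandra1968, Lemma «φ = φ ∗ α»] [cite: Folland1995, Prop. 2.42] -/
theorem exists_centralisation (hι : Continuous ι) (η : C_c(G, ℂ)) :
    ∃ ηK : C_c(G, ℂ), (∀ g, ηK g = ∫ k, η ((ι k)⁻¹ * g * ι k) ∂μK) ∧ ∀ k g, ηK (ι k * g * (ι k)⁻¹) = ηK g := by
  have hFc : Continuous (fun p : G × K => η ((ι p.2)⁻¹ * p.1 * ι p.2)) := continuous_conj_integrand hι η
  -- continuity of the parametric integral over the compact `K`
  have hcont : Continuous (fun g : G => ∫ k, η ((ι k)⁻¹ * g * ι k) ∂μK) := by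
    have h := continuous_parametric_integral_of_continuous (μ := μK) (f := fun g k => η ((ι k)⁻¹ * g * ι k)) hFc isCompact_univ
    simpa only [Measure.restrict_univ] using h
  -- compact support
  set S : Set G := (fun p : K × G => ι p.1 * p.2 * (ι p.1)⁻¹) '' (univ ×ˢ tsupport η) with hS
  have hSc : IsCompact S :=
    (isCompact_univ.prod η.hasCompactSupport).image ((((hι.comp continuous_fst).mul continuous_snd).mul (hι.comp continuous_fst).inv))
  have hsupp : HasCompactSupport (fun g : G => ∫ k, η ((ι k)⁻¹ * g * ι k) ∂μK) := by
    refine HasCompactSupport.intro hSc fun g hg => ?_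
    have hzero : ∀ k, η ((ι k)⁻¹ * g * ι k) = 0 := by
      intro k
      apply image_eq_zero_of_notMem_tsupport
      intro hmem
      exact hg ⟨(k, (ι k)⁻¹ * g * ι k), ⟨mem_univ _, hmem⟩, by simp only; group⟩
    simp only [hzero, integral_zero]
  refine ⟨⟨⟨fun g => ∫ k, η ((ι k)⁻¹ * g * ι k) ∂μK, hcont⟩, hsupp⟩, fun g => rfl, fun k g => ?_⟩
  change ∫ k', η ((ι k')⁻¹ * (ι k * g * (ι k)⁻¹) * ι k') ∂μK = ∫ k', η ((ι k')⁻¹ * g * ι k') ∂μK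
  have h := integral_mul_left_eq_self (μ := μK) (fun k' => η ((ι k')⁻¹ * g * ι k')) k⁻¹
  refine Eq.trans (integral_congr_ae (Eventually.of_forall fun k' => ?_)) h
  change η ((ι k')⁻¹ * (ι k * g * (ι k)⁻¹) * ι k') = η ((ι (k⁻¹ * k'))⁻¹ * g * ι (k⁻¹ * k'))
  congr 1
  rw [map_mul ι, map_inv ι]
  group

omit [IsTopologicalGroup G] [LocallyCompactSpace G] [SecondCountableTopology G] [T2Space G] [MeasurableSpace G] [BorelSpace G] [TopologicalSpace K]
  [IsTopologicalGroup K] [CompactSpace K] [BorelSpace K] [μK.IsHaarMeasure] in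
/-- A centralised REAL NON-NEGATIVE test function is real non-negative. [folklore] -/
theorem re_im_centralisation {η ηK : C_c(G, ℂ)} (hη : ∀ g, 0 ≤ (η g).re ∧ (η g).im = 0) (hηK : ∀ g, ηK g = ∫ k, η ((ι k)⁻¹ * g * ι k) ∂μK) (g : G) :
    0 ≤ (ηK g).re ∧ (ηK g).im = 0 := by
  have hre : ∀ x, (η x : ℂ) = ((η x).re : ℂ) := fun x => Complex.ext (by simp) (by simp [(hη x).2])
  have h : ηK g = ((∫ k, (η ((ι k)⁻¹ * g * ι k)).re ∂μK : ℝ) : ℂ) := by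
    rw [hηK g, ← integral_complex_ofReal]
    exact integral_congr_ae (Eventually.of_forall fun k => hre _)
  rw [h, Complex.ofReal_re, Complex.ofReal_im]
  exact ⟨integral_nonneg fun k => (hη _).1, rfl⟩

/-- **`∫_G re η^K dν = μ_K(K) · ∫_G re η dν`** (Fubini over the compactly supported continuous integrand on `G × K`, then the change of variables `g ↦ (ιk)⁻¹ g ιk` of §1 in the inner
integral). [cite: Folland1995, Prop. 2.42] -/
theorem integral_re_centralisation (hι : Continuous ι) {η ηK : C_c(G, ℂ)} (hηK : ∀ g, ηK g = ∫ k, η ((ι k)⁻¹ * g * ι k) ∂μK) :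
    ∫ g, (ηK g).re ∂ν = (μK univ).toReal * ∫ g, (η g).re ∂ν := by
  have hFc : Continuous (fun p : G × K => (η ((ι p.2)⁻¹ * p.1 * ι p.2)).re) := Complex.continuous_re.comp (continuous_conj_integrand hι η)
  -- compact support of the uncurried real integrand
  have hFs : HasCompactSupport (fun p : G × K => (η ((ι p.2)⁻¹ * p.1 * ι p.2)).re) := by
    set S : Set G := (fun p : K × G => ι p.1 * p.2 * (ι p.1)⁻¹) '' (univ ×ˢ tsupport η) with hS
    have hSc : IsCompact S :=
      (isCompact_univ.prod η.hasCompactSupport).image ((((hι.comp continuous_fst).mul continuous_snd).mul (hι.comp continuous_fst).inv))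
    refine HasCompactSupport.intro (hSc.prod isCompact_univ) fun p hp => ?_
    have hg : p.1 ∉ S := fun h => hp ⟨h, mem_univ _⟩
    have hzero : η ((ι p.2)⁻¹ * p.1 * ι p.2) = 0 := by
      apply image_eq_zero_of_notMem_tsupport
      intro hmem
      exact hg ⟨(p.2, (ι p.2)⁻¹ * p.1 * ι p.2), ⟨mem_univ _, hmem⟩, by simp only; group⟩
    simp only [hzero, Complex.zero_re]
  have hint : Integrable (uncurry fun g k => (η ((ι k)⁻¹ * g * ι k)).re) (ν.prod μK) := hFc.integrable_of_hasCompactSupport hFs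
  -- `re` through the inner integral
  have h1 : ∀ g, (ηK g).re = ∫ k, (η ((ι k)⁻¹ * g * ι k)).re ∂μK := by
    intro g
    rw [hηK g]
    exact (integral_re ((continuous_conj_integrand hι η).comp (Continuous.prodMk_right g) |>.integrable_of_hasCompactSupport
      (HasCompactSupport.of_compactSpace _))).symm
  simp_rw [h1]
  rw [integral_integral_swap hint]
  have h2 : ∀ k, ∫ g, (η ((ι k)⁻¹ * g * ι k)).re ∂ν = ∫ g, (η g).re ∂ν := fun k =>
    (measurePreserving_conj_inv ν hι k).integral_comp (measurableEmbedding_conj_inv' (ι k)) (fun g => (η g).re)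
  simp_rw [h2, integral_const, smul_eq_mul]
  rfl

end Centralisation

/-! ## §3 `π(f)` for `K`-central `f` commutes with `π(ι K)` -/

section Commute

variable {H : Type*} [NormedAddCommGroup H] [InnerProductSpace ℂ H] [CompleteSpace H] {π : ContRepresentation ℂ G H}

omit [IsTopologicalGroup K] in
/-- **`π(ιk) ∘ π(f) = π(f) ∘ π(ιk)` for a `K`-CENTRAL `f`** (`f(ιk·g·(ιk)⁻¹) = f(g)`): the conj-equivariant transport ★ `comp_integratedOperator_of_conj_intertwining` with `T = π(ιk)`,
`θ = (g ↦ ιk·g·(ιk)⁻¹)` (measure-preserving by §1) and `F = f`. [cite: DeitmarEchterhoff2014, Lemma 9.2.7] [cite: HarishChandra1968, Lemma «φ = φ ∗ α»] -/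
theorem comp_integratedOperator_of_central (hu : π.IsUnitary) (hc : π.IsStronglyContinuous) (hι : Continuous ι) (f : C_c(G, ℂ))
    (hf : ∀ k g, f (ι k * g * (ι k)⁻¹) = f g) (k : K) :
    π (ι k) ∘L π.integratedOperator hu hc ν f = π.integratedOperator hu hc ν f ∘L π (ι k) :=
  comp_integratedOperator_of_conj_intertwining hu hc hu hc ν (measurePreserving_conj ν hι k) (measurableEmbedding_conj (ι k)) (π (ι k))
    (fun g x => by
      change (π (ι k) * π g) x = (π (ι k * g * (ι k)⁻¹) * π (ι k)) x
      rw [← map_mul, ← map_mul, inv_mul_cancel_right]) f f (hf k)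

end Commute

/-! ## §4 `K`-central approximate identities -/

omit [LocallyCompactSpace G] [SecondCountableTopology G] [T2Space G] [MeasurableSpace G] [BorelSpace G] [IsTopologicalGroup K] in
/-- **Tube lemma for conjugation**: for `V ∈ 𝓝 1` there is `U ∈ 𝓝 1` with `ιk·u·(ιk)⁻¹ ∈ V` for all `k ∈ K`, `u ∈ U` (compactness of `K`, continuity of `(k, u) ↦ ιk·u·(ιk)⁻¹`).
[folklore] -/
theorem exists_nhds_forall_conj_mem (hι : Continuous ι) {V : Set G} (hV : V ∈ 𝓝 (1 : G)) :
    ∃ U ∈ 𝓝 (1 : G), ∀ (k : K) (u : G), u ∈ U → ι k * u * (ι k)⁻¹ ∈ V := by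
  have hc : Continuous (fun p : K × G => ι p.1 * p.2 * (ι p.1)⁻¹) := ((hι.comp continuous_fst).mul continuous_snd).mul (hι.comp continuous_fst).inv
  have hopen : IsOpen ((fun p : K × G => ι p.1 * p.2 * (ι p.1)⁻¹) ⁻¹' interior V) := isOpen_interior.preimage hc
  have hsub : (univ : Set K) ×ˢ ({1} : Set G) ⊆ (fun p : K × G => ι p.1 * p.2 * (ι p.1)⁻¹) ⁻¹' interior V := by
    rintro ⟨k, u⟩ ⟨-, hu⟩
    rw [mem_singleton_iff] at hu
    subst hu
    change ι k * 1 * (ι k)⁻¹ ∈ interior V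
    rw [mul_one, mul_inv_cancel]
    exact mem_interior_iff_mem_nhds.2 hV
  obtain ⟨u, w, -, hwo, hKu, h1w, huw⟩ := generalized_tube_lemma isCompact_univ isCompact_singleton hopen hsub
  refine ⟨w, hwo.mem_nhds (h1w (mem_singleton 1)), fun k x hx => interior_subset ?_⟩
  exact huw (mk_mem_prod (hKu (mem_univ k)) hx)

/-- **`K`-CENTRAL DIRAC FUNCTIONS**: for every `V ∈ 𝓝 1` there is a `K`-central, real non-negative `f ∈ C_c(G, ℂ)` of `ν`-mass `1` supported in `V` (centralise a ★ `exists_dirac_function` bump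
supported in the `U` of the tube lemma, normalise by §2 `integral_re_centralisation`). [cite: DeitmarEchterhoff2014, Lemma 1.6.5] [cite: HarishChandra1968, Lemma «φ = φ ∗ α»] -/
theorem exists_central_dirac (hι : Continuous ι) {V : Set G} (hV : V ∈ 𝓝 (1 : G)) :
    ∃ f : C_c(G, ℂ), (∀ g, 0 ≤ (f g).re ∧ (f g).im = 0) ∧ (∫ g, (f g).re ∂ν = 1) ∧ tsupport f ⊆ V ∧ ∀ k g, f (ι k * g * (ι k)⁻¹) = f g := by
  borelize K
  -- a closed neighbourhood `V₁ ⊆ V`, and `U` with `ιk U (ιk)⁻¹ ⊆ interior V₁`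
  obtain ⟨V₁, ⟨hV₁, hV₁c⟩, hV₁V⟩ := (closed_nhds_basis (1 : G)).mem_iff.mp hV
  obtain ⟨U, hU, hUV⟩ := exists_nhds_forall_conj_mem (K := K) hι (interior_mem_nhds.2 hV₁)
  -- a bump in `U`, centralised
  obtain ⟨f₀, hf₀, hf₀U, hf₀pos⟩ := exists_dirac_function ν hU
  obtain ⟨ηK, hηK, hcent⟩ := exists_centralisation (Measure.haar : Measure K) hι f₀
  have hri : ∀ g, 0 ≤ (ηK g).re ∧ (ηK g).im = 0 := re_im_centralisation Measure.haar hf₀ hηK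
  -- support of the centralisation
  have hsupp : tsupport ηK ⊆ V₁ := by
    refine closure_minimal (fun g hg => ?_) hV₁c
    -- some `k` with `f₀((ιk)⁻¹ g ιk) ≠ 0`
    by_contra hgV
    apply hg
    rw [hηK g]
    refine integral_eq_zero_of_ae (Eventually.of_forall fun k => ?_)
    by_contra hk
    have hmem : (ι k)⁻¹ * g * ι k ∈ U := hf₀U (subset_tsupport _ hk)
    have := hUV k _ hmem
    rw [show ι k * ((ι k)⁻¹ * g * ι k) * (ι k)⁻¹ = g by group] at this
    exact hgV (interior_subset this)
  -- mass
  set c : ℝ := ∫ g, (ηK g).re ∂ν with hc_def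
  have hc : c = ((Measure.haar : Measure K) univ).toReal * ∫ g, (f₀ g).re ∂ν := integral_re_centralisation ν Measure.haar hι hηK
  have hKpos : 0 < ((Measure.haar : Measure K) univ).toReal :=
    ENNReal.toReal_pos (IsOpenPosMeasure.open_pos univ isOpen_univ univ_nonempty) (measure_ne_top _ _)
  have hcpos : 0 < c := hc ▸ mul_pos hKpos hf₀pos
  refine ⟨((c⁻¹ : ℝ) : ℂ) • ηK, fun g => ?_, ?_, ?_, fun k g => ?_⟩
  · change 0 ≤ (((c⁻¹ : ℝ) : ℂ) * ηK g).re ∧ (((c⁻¹ : ℝ) : ℂ) * ηK g).im = 0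
    rw [Complex.re_ofReal_mul, Complex.im_ofReal_mul, (hri g).2, mul_zero]
    exact ⟨mul_nonneg (inv_nonneg.2 hcpos.le) (hri g).1, rfl⟩
  · change ∫ g, (((c⁻¹ : ℝ) : ℂ) * ηK g).re ∂ν = 1
    simp_rw [Complex.re_ofReal_mul]
    rw [integral_const_mul, ← hc_def, inv_mul_cancel₀ hcpos.ne']
  · refine (closure_mono fun g hg => ?_).trans ((closure_minimal subset_closure (isClosed_tsupport _)).trans (hsupp.trans hV₁V))
    -- support of `c⁻¹ • ηK` lies in the support of `ηK`
    intro h0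
    apply hg
    change ((c⁻¹ : ℝ) : ℂ) * ηK g = 0
    rw [h0, mul_zero]
  · change ((c⁻¹ : ℝ) : ℂ) * ηK (ι k * g * (ι k)⁻¹) = ((c⁻¹ : ℝ) : ℂ) * ηK g
    rw [hcent]

section Approx

variable {H : Type*} [NormedAddCommGroup H] [InnerProductSpace ℂ H] [CompleteSpace H] {π : ContRepresentation ℂ G H}

omit [IsTopologicalGroup G] [LocallyCompactSpace G] [SecondCountableTopology G] [T2Space G] [BorelSpace G] in
/-- **Dirac estimate** [DeitmarEchterhoff2014, Lemma 6.2.2]: for a real non-negative `f ∈ C_c(G)` of `η`-mass `1` and a vector `v` with `‖π(g)v − v‖ ≤ δ` on the support of `f`,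
`‖π(f)v − v‖ ≤ δ` (`π(f)v − v = ∫ f(g)(π(g)v − v) dη`).  Generic twin of ★ `norm_integratedOperator_apply_sub_le_of_integral_eq_one` (module not in the built library).
[cite: DeitmarEchterhoff2014, Lemma 6.2.2] -/
theorem norm_integratedOperator_apply_sub_self_le [OpensMeasurableSpace G] (hu : π.IsUnitary) (hc : π.IsStronglyContinuous) (η : Measure G) [IsFiniteMeasureOnCompacts η]
    (f : C_c(G, ℂ)) (hf : ∀ g, 0 ≤ (f g).re ∧ (f g).im = 0) (hf1 : ∫ g, (f g).re ∂η = 1) (v : H) {δ : ℝ} (hδ : ∀ g ∈ tsupport f, ‖π g v - v‖ ≤ δ) :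
    ‖π.integratedOperator hu hc η f v - v‖ ≤ δ := by
  have hfre : ∀ g, (f g : ℂ) = ((f g).re : ℂ) := fun g => Complex.ext (by simp) (by simp [(hf g).2])
  -- `∫ f(g) • v = v`
  have hcv : ∫ g, f g • v ∂η = v := by
    rw [integral_smul_const, show (∫ g, f g ∂η) = ((∫ g, (f g).re ∂η : ℝ) : ℂ) by
      rw [← integral_complex_ofReal]; exact integral_congr_ae (Eventually.of_forall fun g => hfre g), hf1, Complex.ofReal_one, one_smul]
  have hint : Integrable (fun g => (f g).re * δ) η :=
    ((Complex.continuous_re.comp f.continuous).integrable_of_hasCompactSupport (f.hasCompactSupport.comp_left Complex.zero_re)).mul_const _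
  have hint2 : Integrable (fun g => f g • v) η :=
    (f.continuous.smul continuous_const).integrable_of_hasCompactSupport (f.hasCompactSupport.smul_right : HasCompactSupport ((⇑f) • fun _ : G => v))
  rw [ContRepresentation.integratedOperator_apply]
  nth_rw 2 [← hcv]
  rw [← integral_sub (ContRepresentation.integrable_smul_apply hc η f v) hint2]
  calc ‖∫ g, (f g • π g v - f g • v) ∂η‖ ≤ ∫ g, (f g).re * δ ∂η := by
        refine norm_integral_le_of_norm_le hint (Eventually.of_forall fun g => ?_)
        have hnorm : ‖f g‖ = (f g).re := by
          conv_lhs => rw [hfre g]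
          rw [Complex.norm_real, Real.norm_of_nonneg (hf g).1]
        rw [← smul_sub, norm_smul, hnorm]
        by_cases hg : g ∈ tsupport f
        · exact mul_le_mul_of_nonneg_left (hδ g hg) (hf g).1
        · rw [image_eq_zero_of_notMem_tsupport hg]
          simp
    _ = δ := by rw [integral_mul_const, hf1, one_mul]

/-- **`K`-CENTRAL APPROXIMATE IDENTITY ON VECTORS.**  For a unitary strongly continuous `π`, every vector `v` and every `ε > 0` there is a `K`-central `f ∈ C_c(G, ℂ)` with
**`‖π(f) v − v‖ ≤ ε`** (a `K`-central Dirac function supported in `{g : ‖π(g)v − v‖ < ε}`, ★ `norm_integratedOperator_apply_sub_le_of_integral_eq_one` at `g₀ = 1`).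
[cite: DeitmarEchterhoff2014, Lemma 6.2.2] [cite: HarishChandra1968, Lemma «φ = φ ∗ α»] -/
theorem exists_central_norm_integratedOperator_apply_sub_le (hu : π.IsUnitary) (hc : π.IsStronglyContinuous) (hι : Continuous ι) (v : H) {ε : ℝ} (hε : 0 < ε) :
    ∃ f : C_c(G, ℂ), (∀ k g, f (ι k * g * (ι k)⁻¹) = f g) ∧ ‖π.integratedOperator hu hc ν f v - v‖ ≤ ε := by
  have hV : {g : G | ‖π g v - v‖ < ε} ∈ 𝓝 (1 : G) := by
    refine (isOpen_lt ((hc v).sub continuous_const).norm continuous_const).mem_nhds ?_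
    change ‖π 1 v - v‖ < ε
    rw [map_one]
    change ‖v - v‖ < ε
    rwa [sub_self, norm_zero]
  obtain ⟨f, hf, hf1, hfV, hcent⟩ := exists_central_dirac ν hι hV
  exact ⟨f, hcent, norm_integratedOperator_apply_sub_self_le hu hc ν f hf hf1 v fun g hg => (hfV hg).le⟩

end Approx

end Summit.HodgeConjecture.HodgeConjecture.Cruxes.H413.K2E1CentralTestFunctions

end
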